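import Summits.CriticalPhenomena.PercolationContinuityZ3.Theorems.PercNearOneGluingNoHeavyLowerTailSahiCombFiveUpSetAntipodalExtension
import Summits.CriticalPhenomena.PercolationContinuityZ3.Theorems.PercNearOneGluingNoHeavyLowerTailSahiCombFiveUpSetProof

/-!
# The five-up-set inequality, RANK route VII: step (Z3) of CERT-Z at `a = 2` — the eight D-classes with the HARMONIC directions are jointly independent

Support file of the one-cut programme (crux `NoHeavyLowerTail`, stmt-CriticalPhenomena-4575; cell `prim-masterthm` seat P5, gen 11;
report `P5-LORENTZIAN-TEST.md` §16.12, memo `FROM-prim-masterthm-p5-g11-TOPDOWN-FILTRATION.md` §10–§11).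

The census-validated two-copy certificate CERT-Z for `TRI_W(2) ≥ 0` (report §15.14) has a D-part — the eight classes
`F_x ∩ refl(G_x̄)` (level `x`) and `G_x ∩ refl(F_x̄)` (level `x̄`) for `x` in the square `{0, p, q, 1}` (`p̄ = q`, `0̄ = 1`) — and a K-part.
Here the index square is presented abstractly by eight up-sets `F₀ ⊆ Fp, Fq ⊆ F₁`, `G₀ ⊆ Gp, Gq ⊆ G₁` of the cube `Finset α` (the fibres
`F 0, F p, F q, F 1` of a monotone family on `2²`), and the two copies carry the harmonic directions
`u₀ = e₁, u₁ = e₂, u_p = e₁ + e₂, u_q = e₁ − e₂`: the class pair at `0` lives in copy a, the pair at `1` in copy b, the pair at `p` in both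
with sign `+`, the pair at `q` in both with signs `(+, −)`.

* **`rankZ3_kernel_eq_zero`** — if the eight coefficient vectors (`b0` on `F₀ ∩ refl G₁`, `g0` on `G₀ ∩ refl F₁`, `b1` on `F₁ ∩ refl G₀`,
  `g1` on `G₁ ∩ refl F₀`, `bp` on `Fp ∩ refl Gq`, `gp` on `Gp ∩ refl Fq`, `bq` on `Fq ∩ refl Gp`, `gq` on `Gq ∩ refl Fp`) satisfy the eight
  levelled equations (fibre `0`: copies a, b; fibre `p`; fibre `q`; top fibre), then all of them vanish.
  PROOF (report §16.12; every stage was checked numerically on all `(n,a) = (2,2)` instances): Stage 1 on `F₁ ∩ G₀` — by the antipodal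
  extension lemma (`antipodal_extension`, route VI) and point supports the six classes of levels `0, p, q` vanish there, and the top
  equations then kill `b1` and `g0` (`eq_zero_of_zeta_sum_eq_zero`); Stage 2 on `F₀ ∩ G₁` kills `b0` and `g1` the same way; Stage 3: the
  pairs at `p` and `q` decouple by adding/subtracting the copies into two instances of RANK-Z (`rankZ_kernel_eq_zero`).
What this is NOT: the K-part (step (Z4)) of CERT-Z is not treated, so this file does not prove `TriWIneq` at `a = 2`. [this work]
-/

namespace Summit.CriticalPhenomena.PercolationContinuityZ3.Theorems

namespace FiveUpSet

open Finset

variable {α : Type} [DecidableEq α] [Fintype α]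

/-- The zeta combination `t ↦ Σ_d f d · [d ⊆ t]` of a coefficient vector `f`. [this work] -/
def zsum (f : Finset α → ℚ) (t : Finset α) : ℚ := ∑ d, f d * (if d ⊆ t then (1 : ℚ) else 0)

/-- Point support: if `f` lives on an up-set `Q` then its zeta combination vanishes off `Q`. [this work] -/
theorem zsum_eq_zero_of_not_mem {Q : Finset (Finset α)} (hQ : IsUpperSet (Q : Set (Finset α))) (f : Finset α → ℚ)
    (hf : ∀ d, f d ≠ 0 → d ∈ Q) {t : Finset α} (ht : t ∉ Q) : zsum f t = 0 := by
  unfold zsum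
  refine Finset.sum_eq_zero fun d _ => ?_
  by_cases hd : f d = 0
  · rw [hd, zero_mul]
  · have hdt : ¬ d ⊆ t := fun h' => ht (hQ h' (hf d hd))
    rw [if_neg hdt, mul_zero]

/-- C1 plus point support: if `f` lives on `{d ∈ Q : dᶜ ∈ W}` (`Q, W` up-sets) and its zeta combination vanishes on `Q ∩ W`, then `f = 0`
(this is C2′ in coefficient form). [this work] -/
theorem eq_zero_of_zsum_eq_zero_on {Q W : Finset (Finset α)} (hQ : IsUpperSet (Q : Set (Finset α)))
    (hW : IsUpperSet (W : Set (Finset α))) (f : Finset α → ℚ) (hf : ∀ d, f d ≠ 0 → d ∈ Q ∧ dᶜ ∈ W)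
    (h : ∀ t, t ∈ Q → t ∈ W → zsum f t = 0) : ∀ d, f d = 0 := by
  refine eq_zero_of_zeta_sum_eq_zero hW f (fun d hd => (hf d hd).2) ?_
  intro t htW
  by_cases htQ : t ∈ Q
  · exact h t htQ htW
  · exact zsum_eq_zero_of_not_mem hQ f (fun d hd => (hf d hd).1) htQ

/-- The antipodal extension lemma in `zsum` notation. [this work] -/
theorem zsum_ext {S T : Finset (Finset α)} (hS : IsUpperSet (S : Set (Finset α))) (hT : IsUpperSet (T : Set (Finset α)))
    (f : Finset α → ℚ) (hf : ∀ d, f d ≠ 0 → dᶜ ∈ S) (h : ∀ t, t ∈ S → t ∈ T → zsum f t = 0) :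
    ∀ t, t ∈ T → zsum f t = 0 :=
  antipodal_extension hS hT f hf h

/-- **(Z3) at `a = 2` with the harmonic directions** (report §16.12).  Eight up-sets `F₀ ⊆ Fp, Fq ⊆ F₁`, `G₀ ⊆ Gp, Gq ⊆ G₁`; eight
coefficient vectors with the CERT-Z supports; the levelled two-copy equations with directions `e₁` (pair at `0`), `e₂` (pair at `1`),
`e₁+e₂` (pair at `p`), `e₁−e₂` (pair at `q`): fibre `0` (`t ∈ F₀ ∩ G₀`): copy a `Z b0 = 0`, copy b `Z g1 = 0`; fibre `p` (`t ∈ Fp ∩ Gp`):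
`Z b0 + Z bp + Z gq = 0` and `Z g1 + Z bp − Z gq = 0`; fibre `q` (`t ∈ Fq ∩ Gq`): `Z b0 + Z gp + Z bq = 0` and `Z g1 + Z gp − Z bq = 0`;
top fibre (`t ∈ F₁ ∩ G₁`): `Z b0 + Z g0 + Z bp + Z gp + Z bq + Z gq = 0` and `Z b1 + Z g1 + Z bp + Z gp − Z bq − Z gq = 0`.
Then all eight coefficient vectors are zero. [this work] -/
theorem rankZ3_kernel_eq_zero (F₀ Fp Fq F₁ G₀ Gp Gq G₁ : Finset (Finset α))
    (hF₀ : IsUpperSet (F₀ : Set (Finset α))) (hFp : IsUpperSet (Fp : Set (Finset α))) (hFq : IsUpperSet (Fq : Set (Finset α)))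
    (hF₁ : IsUpperSet (F₁ : Set (Finset α))) (hG₀ : IsUpperSet (G₀ : Set (Finset α))) (hGp : IsUpperSet (Gp : Set (Finset α)))
    (hGq : IsUpperSet (Gq : Set (Finset α))) (hG₁ : IsUpperSet (G₁ : Set (Finset α)))
    (hF0p : F₀ ⊆ Fp) (hF0q : F₀ ⊆ Fq) (hFp1 : Fp ⊆ F₁) (hFq1 : Fq ⊆ F₁)
    (hG0p : G₀ ⊆ Gp) (hG0q : G₀ ⊆ Gq) (hGp1 : Gp ⊆ G₁) (hGq1 : Gq ⊆ G₁)
    (b0 g0 b1 g1 bp gp bq gq : Finset α → ℚ)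
    (sb0 : ∀ d, b0 d ≠ 0 → d ∈ F₀ ∧ dᶜ ∈ G₁) (sg0 : ∀ d, g0 d ≠ 0 → d ∈ G₀ ∧ dᶜ ∈ F₁)
    (sb1 : ∀ d, b1 d ≠ 0 → d ∈ F₁ ∧ dᶜ ∈ G₀) (sg1 : ∀ d, g1 d ≠ 0 → d ∈ G₁ ∧ dᶜ ∈ F₀)
    (sbp : ∀ d, bp d ≠ 0 → d ∈ Fp ∧ dᶜ ∈ Gq) (sgp : ∀ d, gp d ≠ 0 → d ∈ Gp ∧ dᶜ ∈ Fq)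
    (sbq : ∀ d, bq d ≠ 0 → d ∈ Fq ∧ dᶜ ∈ Gp) (sgq : ∀ d, gq d ≠ 0 → d ∈ Gq ∧ dᶜ ∈ Fp)
    (e0a : ∀ t, t ∈ F₀ → t ∈ G₀ → zsum b0 t = 0)
    (e0b : ∀ t, t ∈ F₀ → t ∈ G₀ → zsum g1 t = 0)
    (epa : ∀ t, t ∈ Fp → t ∈ Gp → zsum b0 t + zsum bp t + zsum gq t = 0)
    (epb : ∀ t, t ∈ Fp → t ∈ Gp → zsum g1 t + zsum bp t - zsum gq t = 0)
    (eqa : ∀ t, t ∈ Fq → t ∈ Gq → zsum b0 t + zsum gp t + zsum bq t = 0)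
    (eqb : ∀ t, t ∈ Fq → t ∈ Gq → zsum g1 t + zsum gp t - zsum bq t = 0)
    (e1a : ∀ t, t ∈ F₁ → t ∈ G₁ → zsum b0 t + zsum g0 t + zsum bp t + zsum gp t + zsum bq t + zsum gq t = 0)
    (e1b : ∀ t, t ∈ F₁ → t ∈ G₁ → zsum b1 t + zsum g1 t + zsum bp t + zsum gp t - zsum bq t - zsum gq t = 0) :
    (∀ d, b0 d = 0) ∧ (∀ d, g0 d = 0) ∧ (∀ d, b1 d = 0) ∧ (∀ d, g1 d = 0) ∧
      (∀ d, bp d = 0) ∧ (∀ d, gp d = 0) ∧ (∀ d, bq d = 0) ∧ (∀ d, gq d = 0) := by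
  -- up-set intersections used below
  have hT : IsUpperSet ((F₁ ∩ G₀ : Finset (Finset α)) : Set (Finset α)) := by rw [coe_inter]; exact hF₁.inter hG₀
  have hT' : IsUpperSet ((F₀ ∩ G₁ : Finset (Finset α)) : Set (Finset α)) := by rw [coe_inter]; exact hF₀.inter hG₁
  -- point supports (vanishing off the support up-set)
  have pb0 : ∀ t, t ∉ F₀ → zsum b0 t = 0 := fun t ht => zsum_eq_zero_of_not_mem hF₀ b0 (fun d hd => (sb0 d hd).1) ht
  have pg0 : ∀ t, t ∉ G₀ → zsum g0 t = 0 := fun t ht => zsum_eq_zero_of_not_mem hG₀ g0 (fun d hd => (sg0 d hd).1) ht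
  have pbp : ∀ t, t ∉ Fp → zsum bp t = 0 := fun t ht => zsum_eq_zero_of_not_mem hFp bp (fun d hd => (sbp d hd).1) ht
  have pgp : ∀ t, t ∉ Gp → zsum gp t = 0 := fun t ht => zsum_eq_zero_of_not_mem hGp gp (fun d hd => (sgp d hd).1) ht
  have pbq : ∀ t, t ∉ Fq → zsum bq t = 0 := fun t ht => zsum_eq_zero_of_not_mem hFq bq (fun d hd => (sbq d hd).1) ht
  have pgq : ∀ t, t ∉ Gq → zsum gq t = 0 := fun t ht => zsum_eq_zero_of_not_mem hGq gq (fun d hd => (sgq d hd).1) ht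
  /- STAGE 1 on `T = F₁ ∩ G₀`. -/
  -- (a) `Z g1 = 0` on `F₁ ∩ G₀` (antipodal extension from `F₀ ∩ (F₁ ∩ G₀) ⊆ F₀ ∩ G₀`)
  have a1 : ∀ t, t ∈ F₁ ∩ G₀ → zsum g1 t = 0 := by
    refine zsum_ext hF₀ hT g1 (fun d hd => (sg1 d hd).2) ?_
    intro t htF0 htT
    exact e0b t htF0 (mem_inter.1 htT).2
  -- (b) `Z bp = Z gq = 0` on `Fp ∩ G₀`
  have hst1 : ∀ t, t ∈ Fp → t ∈ G₀ → zsum bp t = 0 ∧ zsum gq t = 0 := by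
    intro t htFp htG0
    have hb0 : zsum b0 t = 0 := by
      by_cases h0 : t ∈ F₀
      · exact e0a t h0 htG0
      · exact pb0 t h0
    have hg1 : zsum g1 t = 0 := a1 t (mem_inter.2 ⟨hFp1 htFp, htG0⟩)
    have h1 := epa t htFp (hG0p htG0)
    have h2 := epb t htFp (hG0p htG0)
    rw [hb0] at h1; rw [hg1] at h2
    constructor <;> linarith
  -- (c) `Z gq = 0` and `Z bp = 0` on `F₁ ∩ G₀`
  have cgq : ∀ t, t ∈ F₁ ∩ G₀ → zsum gq t = 0 := by
    refine zsum_ext hFp hT gq (fun d hd => (sgq d hd).2) ?_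
    intro t htFp htT
    exact (hst1 t htFp (mem_inter.1 htT).2).2
  have cbp : ∀ t, t ∈ F₁ ∩ G₀ → zsum bp t = 0 := by
    intro t ht
    by_cases htFp : t ∈ Fp
    · exact (hst1 t htFp (mem_inter.1 ht).2).1
    · exact pbp t htFp
  -- (d) symmetrically `Z gp = Z bq = 0` on `Fq ∩ G₀`, then on `F₁ ∩ G₀`
  have d1 : ∀ t, t ∈ Fq → t ∈ G₀ → zsum gp t = 0 ∧ zsum bq t = 0 := by
    intro t htFq htG0
    have hb0 : zsum b0 t = 0 := by
      by_cases h0 : t ∈ F₀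
      · exact e0a t h0 htG0
      · exact pb0 t h0
    have hg1 : zsum g1 t = 0 := a1 t (mem_inter.2 ⟨hFq1 htFq, htG0⟩)
    have h1 := eqa t htFq (hG0q htG0)
    have h2 := eqb t htFq (hG0q htG0)
    rw [hb0] at h1; rw [hg1] at h2
    constructor <;> linarith
  have dgp : ∀ t, t ∈ F₁ ∩ G₀ → zsum gp t = 0 := by
    refine zsum_ext hFq hT gp (fun d hd => (sgp d hd).2) ?_
    intro t htFq htT
    exact (d1 t htFq (mem_inter.1 htT).2).1
  have dbq : ∀ t, t ∈ F₁ ∩ G₀ → zsum bq t = 0 := by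
    intro t ht
    by_cases htFq : t ∈ Fq
    · exact (d1 t htFq (mem_inter.1 ht).2).2
    · exact pbq t htFq
  -- (e) `Z b0 = 0` on `F₁ ∩ G₀`
  have eb0 : ∀ t, t ∈ F₁ ∩ G₀ → zsum b0 t = 0 := by
    intro t ht
    by_cases h0 : t ∈ F₀
    · exact e0a t h0 (mem_inter.1 ht).2
    · exact pb0 t h0
  -- (f) `b1 = 0`: the top equation of copy b on `F₁ ∩ G₀` gives `Z b1 = 0` there; C2′
  have fb1 : ∀ d, b1 d = 0 := by
    refine eq_zero_of_zsum_eq_zero_on hF₁ hG₀ b1 sb1 ?_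
    intro t htF1 htG0
    have ht : t ∈ F₁ ∩ G₀ := mem_inter.2 ⟨htF1, htG0⟩
    have h := e1b t htF1 (hGp1 (hG0p htG0))
    rw [a1 t ht, cbp t ht, dgp t ht, dbq t ht, cgq t ht] at h
    linarith
  -- (g) `g0 = 0`: the top equation of copy a on `F₁ ∩ G₀`
  have gg0 : ∀ d, g0 d = 0 := by
    refine eq_zero_of_zsum_eq_zero_on hG₀ hF₁ g0 sg0 ?_
    intro t htG0 htF1
    have ht : t ∈ F₁ ∩ G₀ := mem_inter.2 ⟨htF1, htG0⟩
    have h := e1a t htF1 (hGp1 (hG0p htG0))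
    rw [eb0 t ht, cbp t ht, dgp t ht, dbq t ht, cgq t ht] at h
    linarith
  have zb1 : ∀ t, zsum b1 t = 0 := by
    intro t; unfold zsum; exact Finset.sum_eq_zero fun d _ => by rw [fb1 d, zero_mul]
  have zg0 : ∀ t, zsum g0 t = 0 := by
    intro t; unfold zsum; exact Finset.sum_eq_zero fun d _ => by rw [gg0 d, zero_mul]
  /- STAGE 2 on `T' = F₀ ∩ G₁`. -/
  -- on `F₀ ∩ Gp`: `Z gp = Z bq = 0`
  have s2a : ∀ t, t ∈ F₀ → t ∈ Gp → zsum gp t = 0 ∧ zsum bq t = 0 := by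
    intro t htF0 htGp
    have h1a := e1a t (hFp1 (hF0p htF0)) (hGp1 htGp)
    have h1b := e1b t (hFp1 (hF0p htF0)) (hGp1 htGp)
    have hpa := epa t (hF0p htF0) htGp
    have hpb := epb t (hF0p htF0) htGp
    rw [zg0 t] at h1a; rw [zb1 t] at h1b
    constructor <;> linarith
  -- on `F₀ ∩ Gq`: `Z bp = Z gq = 0`
  have s2b : ∀ t, t ∈ F₀ → t ∈ Gq → zsum bp t = 0 ∧ zsum gq t = 0 := by
    intro t htF0 htGq
    have h1a := e1a t (hFq1 (hF0q htF0)) (hGq1 htGq)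
    have h1b := e1b t (hFq1 (hF0q htF0)) (hGq1 htGq)
    have hqa := eqa t (hF0q htF0) htGq
    have hqb := eqb t (hF0q htF0) htGq
    rw [zg0 t] at h1a; rw [zb1 t] at h1b
    constructor <;> linarith
  -- extend to `F₀ ∩ G₁`
  have s2bp : ∀ t, t ∈ F₀ ∩ G₁ → zsum bp t = 0 := by
    refine zsum_ext hGq hT' bp (fun d hd => (sbp d hd).2) ?_
    intro t htGq htT
    exact (s2b t (mem_inter.1 htT).1 htGq).1
  have s2bq : ∀ t, t ∈ F₀ ∩ G₁ → zsum bq t = 0 := by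
    refine zsum_ext hGp hT' bq (fun d hd => (sbq d hd).2) ?_
    intro t htGp htT
    exact (s2a t (mem_inter.1 htT).1 htGp).2
  have s2gp : ∀ t, t ∈ F₀ ∩ G₁ → zsum gp t = 0 := by
    intro t ht
    by_cases htGp : t ∈ Gp
    · exact (s2a t (mem_inter.1 ht).1 htGp).1
    · exact pgp t htGp
  have s2gq : ∀ t, t ∈ F₀ ∩ G₁ → zsum gq t = 0 := by
    intro t ht
    by_cases htGq : t ∈ Gq
    · exact (s2b t (mem_inter.1 ht).1 htGq).2
    · exact pgq t htGq
  -- `b0 = 0` and `g1 = 0`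
  have fb0 : ∀ d, b0 d = 0 := by
    refine eq_zero_of_zsum_eq_zero_on hF₀ hG₁ b0 sb0 ?_
    intro t htF0 htG1
    have ht : t ∈ F₀ ∩ G₁ := mem_inter.2 ⟨htF0, htG1⟩
    have h := e1a t (hFp1 (hF0p htF0)) htG1
    rw [zg0 t, s2bp t ht, s2gp t ht, s2bq t ht, s2gq t ht] at h
    linarith
  have fg1 : ∀ d, g1 d = 0 := by
    refine eq_zero_of_zsum_eq_zero_on hG₁ hF₀ g1 sg1 ?_
    intro t htG1 htF0
    have ht : t ∈ F₀ ∩ G₁ := mem_inter.2 ⟨htF0, htG1⟩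
    have h := e1b t (hFp1 (hF0p htF0)) htG1
    rw [zb1 t, s2bp t ht, s2gp t ht, s2bq t ht, s2gq t ht] at h
    linarith
  have zb0 : ∀ t, zsum b0 t = 0 := by
    intro t; unfold zsum; exact Finset.sum_eq_zero fun d _ => by rw [fb0 d, zero_mul]
  have zg1 : ∀ t, zsum g1 t = 0 := by
    intro t; unfold zsum; exact Finset.sum_eq_zero fun d _ => by rw [fg1 d, zero_mul]
  /- STAGE 3: the pairs at `p` and at `q` are two RANK-Z systems. -/
  have hp := rankZ_kernel_eq_zero Fq F₁ Gq G₁ hFq hF₁ hGq hG₁ hFq1 hGq1 bp gp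
    (fun d hd => ⟨hFp1 (sbp d hd).1, (sbp d hd).2⟩)
    (fun d hd => Or.inl ⟨(sgp d hd).2, hGp1 (sgp d hd).1⟩) ?_ ?_
  rotate_left
  · intro t htF1 htG1
    have h1 := e1a t htF1 htG1
    have h2 := e1b t htF1 htG1
    rw [zb0 t, zg0 t] at h1; rw [zb1 t, zg1 t] at h2
    unfold zsum at h1 h2
    linarith
  · intro t htFq htGq
    have h1 := eqa t htFq htGq
    have h2 := eqb t htFq htGq
    rw [zb0 t] at h1; rw [zg1 t] at h2
    unfold zsum at h1 h2
    linarith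
  have hq := rankZ_kernel_eq_zero Fp F₁ Gp G₁ hFp hF₁ hGp hG₁ hFp1 hGp1 bq gq
    (fun d hd => ⟨hFq1 (sbq d hd).1, (sbq d hd).2⟩)
    (fun d hd => Or.inl ⟨(sgq d hd).2, hGq1 (sgq d hd).1⟩) ?_ ?_
  rotate_left
  · intro t htF1 htG1
    have h1 := e1a t htF1 htG1
    have h2 := e1b t htF1 htG1
    rw [zb0 t, zg0 t] at h1; rw [zb1 t, zg1 t] at h2
    unfold zsum at h1 h2
    linarith
  · intro t htFp htGp
    have h1 := epa t htFp htGp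
    have h2 := epb t htFp htGp
    rw [zb0 t] at h1; rw [zg1 t] at h2
    unfold zsum at h1 h2
    linarith
  exact ⟨fb0, gg0, fb1, fg1, hp.1, hp.2, hq.1, hq.2⟩

end FiveUpSet

end Summit.CriticalPhenomena.PercolationContinuityZ3.Theorems
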